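import Summits.ResolutionOfSingularities.ResolutionOfSingularities.Theorems.FrobeniusLadderFRationalResolutionRootAdjoinUnits
import Summits.ResolutionOfSingularities.ResolutionOfSingularities.Theorems.FrobeniusLadderFRationalResolutionFixedChartOfSummand
import Literature.AlgebraicGeometry.Resolution.FieldsJ2
import Mathlib.RingTheory.Localization.LocalizationLocalization
import HarnessLib

/-!
# Crux `FrobeniusLadder.FRationalResolution` (stmt-ResolutionOfSingularities-15317), line `redirect`,
# stub `stub_diagonalizableQuotientResolution` — item (F2) NON-SPLIT case ASSEMBLED in the stub's frame, modulo the regularity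
# of the root-adjunction ring at the point: `B_𝔔 + ⟨a⟩ = A`, `d•a = deg u`, `u ∉ 𝔔` ⇒ the point is the image of a FIXED point of a
# quotient chart of the same shape with the same invariants

Pipeline (MEMO-15317-leafhand2-g21 §2): chart `(A, S)` of hq's shape, point `v`, prime `𝔔` over `v` with unit-degree subgroup
`B`; a homogeneous `u ∈ S_b ∖ 𝔔`, `a ∈ A` and `d ≥ 2` with `d • a = b`, `B ⊔ ⟨a⟩ = ⊤` and `j • a ∉ B` for `0 < j < d`. Then
(R) `S̃ = S[w]/(w^d − u)` is graded by `A × ZMod d` with invariants `S₀` (`…RootAdjoinChart`), its unit-degree subgroup `B̃` at a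
prime `𝔔̃` over `𝔔` satisfies `B̃ ⊔ C̃ = ⊤`, `B̃ ⊓ C̃ = ⊥` for `C̃ = 0 × ZMod d` (`…RootAdjoinUnits`); after inverting one
`t ∈ S₀ ∖ 𝔮` the ring `S̃_t` is REGULAR provided `S̃` is regular at the primes over `𝔮` (`exists_isRegularRing_away`: the
regular locus of a finitely generated algebra over a field is open — Matsumura Cor. 30.5, `Literature…isOpen_regularLocus_of_
finiteType_field` — and `Spec S̃ → Spec S₀` is closed); and (S) `…FixedChartOfSummand.exists_fixed_chart_of_isCompl` applied
to the chart `(A × ZMod d, S̃_t)` produces the fixed chart.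

* `exists_isRegularRing_away` — `B` of finite type over a field, integral over `R₀`, regular at the primes over `𝔮 ⊂ R₀` ⇒
  `B_t` regular for some `t ∈ R₀ ∖ 𝔮`;
* `unitDegrees_away_iff` — unit degrees at `𝔔` do not change under localization away from a degree-zero element outside `𝔔`;
* ★★ `exists_fixed_chart_of_rootAdjoin` — the assembled statement, with the ONE hypothesis `hreg`: `S̃ = AdjoinRoot (X^d − C u)`
  is a regular local ring at every prime lying over `v` (automatic for `p ∤ d`; for `p ∣ d` see MEMO-15317-leafhand2-g21 §3).

E.g. `A = ℤ/p²`, `B_𝔔 = pA` (a `μ_{p²}`-quotient point with wild stabiliser `μ_p`), `a = 1`, `d = p`, `u` a homogeneous element of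
degree `p` outside `𝔔`. Honest label: helper toward ONE leaf stub (conditional on `hreg`); no stub, crux or summit closed. No
definitions, no named facts, no sorry. [folklore; cite: SGA3, Exp. VIII §4–5] [cite: Matsumura1987, §30, Cor. to Thm. 30.5]
[cite: StacksProject, Tag 07NG]
-/

noncomputable section

-- single-problem summit: the doubled namespace component is forced
set_option linter.dupNamespace false

open CategoryTheory AlgebraicGeometry Polynomial
open Literature.RingTheory.GradedAlgebra
open Literature.AlgebraicGeometry.Resolution
open Literature.AlgebraicGeometry.Resolution.DiagonalizableQuotient

namespace Summit.ResolutionOfSingularities.ResolutionOfSingularities.Theorems.FRationalResolution.FixedChartOfRoot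

universe u v w

/-! ### Shrinking to the regular locus -/

/-- **Regular at the primes over `𝔮` ⇒ regular after inverting one element of `R₀ ∖ 𝔮`.** `B` of finite type over a field `k`
and integral over `R₀`; if `B_𝔓` is regular for every prime `𝔓` of `B` over the prime `𝔮` of `R₀`, then `B_t` is a regular ring
for some `t ∈ R₀ ∖ 𝔮` (openness of the regular locus, Matsumura Cor. 30.5; `Spec B → Spec R₀` is closed).
[cite: Matsumura1987, §30, Cor. to Thm. 30.5] -/
theorem exists_isRegularRing_away (k : Type u) [Field k] {R₀ B : Type u} [CommRing R₀] [CommRing B] [Algebra k B]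
    [Algebra.FiniteType k B] [Algebra R₀ B] [Algebra.IsIntegral R₀ B] (𝔮 : Ideal R₀) [𝔮.IsPrime]
    (hreg : ∀ (𝔓 : Ideal B) [𝔓.IsPrime], 𝔓.comap (algebraMap R₀ B) = 𝔮 → IsRegularLocalRing (Localization.AtPrime 𝔓)) :
    ∃ t : R₀, t ∉ 𝔮 ∧ IsRegularRing (Localization.Away (algebraMap R₀ B t)) := by
  haveI : IsNoetherianRing B := Algebra.FiniteType.isNoetherianRing k B
  set Z : Set (PrimeSpectrum B) := (regularLocus B)ᶜ with hZ
  have hZc : IsClosed Z := (isOpen_regularLocus_of_finiteType_field k B).isClosed_compl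
  set π := PrimeSpectrum.comap (algebraMap R₀ B) with hπ
  have hπc : IsClosedMap π :=
    PrimeSpectrum.isClosedMap_comap_of_isIntegral _ fun x => Algebra.IsIntegral.isIntegral x
  have hv : (⟨𝔮, inferInstance⟩ : PrimeSpectrum R₀) ∈ (π '' Z)ᶜ := by
    rintro ⟨P, hPZ, hPv⟩
    refine hPZ ((mem_regularLocus P).2 (hreg P.asIdeal ?_))
    have h := congrArg PrimeSpectrum.asIdeal hPv
    rwa [hπ, PrimeSpectrum.comap_asIdeal] at h
  obtain ⟨U, ⟨t, rfl⟩, hvU, hUZ⟩ :=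
    PrimeSpectrum.isTopologicalBasis_basic_opens.exists_subset_of_mem_open hv (hπc Z hZc).isOpen_compl
  refine ⟨t, fun ht => ((PrimeSpectrum.mem_basicOpen t _).1 hvU) ht, ?_⟩
  set Bt := Localization.Away (algebraMap R₀ B t)
  haveI : IsNoetherianRing Bt := IsLocalization.isNoetherianRing (Submonoid.powers (algebraMap R₀ B t)) Bt inferInstance
  refine isRegularRing_iff.2 fun P hP => ?_
  set 𝔓 : Ideal B := P.comap (algebraMap B Bt) with h𝔓
  haveI : 𝔓.IsPrime := Ideal.IsPrime.comap _
  have ht𝔓 : algebraMap R₀ B t ∉ 𝔓 := fun h =>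
    hP.ne_top (Ideal.eq_top_of_isUnit_mem _ (Ideal.mem_comap.1 h) (IsLocalization.Away.algebraMap_isUnit _))
  have hreg𝔓 : (⟨𝔓, inferInstance⟩ : PrimeSpectrum B) ∈ regularLocus B := by
    by_contra hZ'
    have hmem : π ⟨𝔓, inferInstance⟩ ∈ (PrimeSpectrum.basicOpen t : Set (PrimeSpectrum R₀)) := by
      rw [SetLike.mem_coe, PrimeSpectrum.mem_basicOpen, hπ, PrimeSpectrum.comap_asIdeal, Ideal.mem_comap]
      exact ht𝔓
    exact hUZ hmem ⟨_, hZ', rfl⟩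
  rw [mem_regularLocus] at hreg𝔓
  exact IsRegularLocalRing.of_ringEquiv
    (IsLocalization.localizationLocalizationAtPrimeIsoLocalization (Submonoid.powers (algebraMap R₀ B t)) P).toRingEquiv

/-! ### Unit degrees under localization away from a degree-zero element -/

/-- **Unit degrees at `𝔔` are unchanged under `T → T_g`** (`g ∈ T_0 ∖ 𝔔`). [folklore; cite: EGAII, (2.2.1)] -/
theorem unitDegrees_away_iff {k : Type u} [CommRing k] {A : Type w} [DecidableEq A] [AddMonoid A] {T : Type v}
    [CommRing T] [Algebra k T] (𝒯 : A → Submodule k T) [GradedAlgebra 𝒯] {g : T}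
    (hT : ∀ t ∈ Submonoid.powers g, t ∈ 𝒯 0) (L : Type v) [CommRing L] [Algebra T L] [Algebra k L]
    [IsScalarTower k T L] [IsLocalization.Away g L] (𝔔 : Ideal T) [𝔔.IsPrime] (hg : g ∉ 𝔔) (i : A) :
    (∃ x ∈ locPiece 𝒯 (Submonoid.powers g) hT L i, x ∉ 𝔔.map (algebraMap T L)) ↔ ∃ x ∈ 𝒯 i, x ∉ 𝔔 := by
  have hdisj : Disjoint ((Submonoid.powers g : Submonoid T) : Set T) (𝔔 : Set T) := by
    rw [Set.disjoint_left]
    rintro _ ⟨n, rfl⟩ h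
    exact hg ((inferInstance : 𝔔.IsPrime).mem_of_pow_mem n h)
  have hprime : (𝔔.map (algebraMap T L)).IsPrime :=
    IsLocalization.isPrime_of_isPrime_disjoint (Submonoid.powers g) L 𝔔 inferInstance hdisj
  have hcomap : (𝔔.map (algebraMap T L)).comap (algebraMap T L) = 𝔔 :=
    IsLocalization.under_map_of_isPrime_disjoint (Submonoid.powers g) L inferInstance hdisj
  constructor
  · rintro ⟨x, hx, hxQ⟩
    obtain ⟨t, ht, y, hy, hxy⟩ := (mem_locPiece_iff hT).1 hx
    refine ⟨y, hy, fun hyQ => hxQ ?_⟩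
    have h1 : algebraMap T L t * x ∈ 𝔔.map (algebraMap T L) := by
      rw [hxy]; exact Ideal.mem_map_of_mem _ hyQ
    rcases hprime.mem_or_mem h1 with h | h
    · exfalso
      obtain ⟨n, rfl⟩ := ht
      have : g ^ n ∈ 𝔔 := by rw [← hcomap, Ideal.mem_comap]; exact h
      exact hg ((inferInstance : 𝔔.IsPrime).mem_of_pow_mem n this)
    · exact h
  · rintro ⟨y, hy, hyQ⟩
    refine ⟨algebraMap T L y, algebraMap_mem_locPiece hT hy, fun h => hyQ ?_⟩
    rw [← hcomap, Ideal.mem_comap]; exact h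

/-! ### The assembled re-charting -/

/-- ★★ **Item (F2), non-split case (modulo `hreg`): a point whose unit-degree subgroup `B` becomes all of `A` with one more
degree `a` of order `d` modulo `B`, `d • a = deg u` for a homogeneous `u ∉ 𝔔`, is the image of a FIXED point of a quotient
chart of the same shape with the same invariants — provided `S̃ = S[w]/(w^d − u)` is regular at the primes over the point.**
No tameness hypothesis. [folklore; cite: SGA3, Exp. VIII §4–5] [cite: Matsumura1987, §30, Cor. to Thm. 30.5]
[cite: StacksProject, Tag 07NG] -/
theorem exists_fixed_chart_of_rootAdjoin (k : Type) [Field k] (X : Scheme.{0}) (g : X ⟶ Spec (.of k))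
    (A : Type) [AddCommGroup A] [Finite A] [DecidableEq A] (S : Type) [CommRing S] [Algebra k S]
    (𝒮 : A → Submodule k S) [GradedAlgebra 𝒮] [Algebra.FiniteType k S]
    (φ : Spec (.of (𝒮 0)) ⟶ X) [Etale φ]
    (hφg : φ ≫ g = Spec.map (CommRingCat.ofHom (algebraMap k (𝒮 0))))
    (v : Spec (.of (𝒮 0))) (𝔔 : Ideal S) [𝔔.IsPrime] (h𝔔v : 𝔔.comap (algebraMap (𝒮 0) S) = v.asIdeal)
    (B : AddSubgroup A) (hB : ∀ i : A, i ∈ B ↔ ∃ s ∈ 𝒮 i, s ∉ 𝔔)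
    (u : S) (b : A) (hu : u ∈ 𝒮 b) (huQ : u ∉ 𝔔) (a : A) (d : ℕ) (hd : 1 < d) (hab : d • a = b)
    (hgen : B ⊔ AddSubgroup.zmultiples a = ⊤) (hmin : ∀ j : ℕ, 0 < j → j < d → j • a ∉ B)
    (hreg : ∀ (𝔓 : Ideal (AdjoinRoot (Polynomial.X ^ d - Polynomial.C u : Polynomial S))) [𝔓.IsPrime],
      𝔓.comap (algebraMap (𝒮 0) (AdjoinRoot (Polynomial.X ^ d - Polynomial.C u : Polynomial S))) = v.asIdeal →
        IsRegularLocalRing (Localization.AtPrime 𝔓)) :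
    ∃ (A' : Type) (_ : AddCommGroup A') (_ : Finite A') (_ : DecidableEq A')
      (S' : Type) (_ : CommRing S') (_ : Algebra k S') (𝒮' : A' → Submodule k S')
      (_ : GradedAlgebra 𝒮'),
      Algebra.FiniteType k S' ∧ IsRegularRing S' ∧
      ∃ (φ' : Spec (.of (𝒮' 0)) ⟶ X), Etale φ' ∧
        φ' ≫ g = Spec.map (CommRingCat.ofHom (algebraMap k (𝒮' 0))) ∧
        ∃ (v' : Spec (.of (𝒮' 0))) (𝔔' : Ideal S') (_ : 𝔔'.IsPrime),
          𝔔'.comap (algebraMap (𝒮' 0) S') = v'.asIdeal ∧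
          (∀ c : A', c ≠ 0 → ∀ s ∈ 𝒮' c, s ∈ 𝔔') ∧ φ' v' = φ v := by
  classical
  haveI : Fact (1 < d) := ⟨hd⟩
  haveI : NeZero d := ⟨by omega⟩
  haveI : Nontrivial S := FixedChartOfSummand.nontrivial_of_ne_top 𝔔 (inferInstance : 𝔔.IsPrime).ne_top
  have hA : AddMonoid.IsTorsion A := fun i => isOfFinAddOrder_of_finite i
  -- (R) the root-adjunction chart
  set P : Polynomial S := Polynomial.X ^ d - Polynomial.C u with hP
  obtain ⟨𝒯, inst𝒯, h𝒯⟩ := RootAdjoinChart.exists_rootGrading 𝒮 d u a b hu hab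
  haveI : Algebra.FiniteType k (AdjoinRoot P) := RootAdjoinChart.finiteType (k := k) d u
  obtain ⟨e, he⟩ := RootAdjoinChart.exists_ringEquiv_gradeZero 𝒮 d u a 𝒯 h𝒯
  -- a prime over `𝔔` and its contractions
  obtain ⟨𝔔', h𝔔'p, h𝔔'⟩ := RootAdjoinUnits.exists_prime_over d u 𝔔
  haveI := h𝔔'p
  have halg0 : ∀ x : 𝒮 0, algebraMap (𝒮 0) (AdjoinRoot P) x = AdjoinRoot.of P (x : S) := fun x => rfl
  have hcomap0 : ∀ (𝔓 : Ideal (AdjoinRoot P)), 𝔓.comap (algebraMap (𝒮 0) (AdjoinRoot P)) =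
      (𝔓.comap (AdjoinRoot.of P)).comap (algebraMap (𝒮 0) S) := fun 𝔓 => by
    ext x; simp only [Ideal.mem_comap, halg0]; rfl
  have h𝔔'v : 𝔔'.comap (algebraMap (𝒮 0) (AdjoinRoot P)) = v.asIdeal := by rw [hcomap0, h𝔔', h𝔔v]
  -- shrink: `S̃_t` regular for some `t ∈ S₀ ∖ 𝔮`
  haveI : Module.Finite S (AdjoinRoot P) := RootAdjoinChart.module_finite d u
  haveI : Algebra.IsIntegral S (AdjoinRoot P) := Algebra.IsIntegral.of_finite S _
  haveI : Algebra.IsIntegral (𝒮 0) S := DiagonalizableQuotient.algebra_isIntegral 𝒮 hA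
  haveI : Algebra.IsIntegral (𝒮 0) (AdjoinRoot P) := Algebra.IsIntegral.trans S
  haveI : v.asIdeal.IsPrime := v.isPrime
  obtain ⟨t₀, ht₀v, hregL⟩ := exists_isRegularRing_away k (R₀ := 𝒮 0) (B := AdjoinRoot P) v.asIdeal
    (fun 𝔓 _ h𝔓 => hreg 𝔓 h𝔓)
  set t : AdjoinRoot P := algebraMap (𝒮 0) (AdjoinRoot P) t₀ with ht
  have ht0 : t ∈ 𝒯 0 := by rw [ht, halg0]; exact RootAdjoinChart.of_mem 𝒮 d u a 𝒯 h𝒯 t₀.2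
  have htQ : t ∉ 𝔔' := fun h => ht₀v (by rw [← h𝔔'v, Ideal.mem_comap]; exact h)
  have hT : ∀ s ∈ Submonoid.powers t, s ∈ 𝒯 0 := AwayUnits.powers_subset_gradeZero 𝒯 ht0
  let L : Type := Localization.Away t
  haveI : IsRegularRing L := hregL
  let ℒ : (A × ZMod d) → Submodule k L := locPiece 𝒯 (Submonoid.powers t) hT L
  letI instℒ : GradedAlgebra ℒ := (nonempty_gradedAlgebra_locPiece 𝒯 _ hT L).some
  haveI : Algebra.FiniteType k L := by
    show Algebra.FiniteType k (Localization (Submonoid.powers t))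
    infer_instance
  -- the prime of `L` and the unit-degree subgroup
  have hdisj : Disjoint ((Submonoid.powers t : Submonoid (AdjoinRoot P)) : Set (AdjoinRoot P)) (𝔔' : Set (AdjoinRoot P)) := by
    rw [Set.disjoint_left]
    rintro _ ⟨n, rfl⟩ h
    exact htQ (h𝔔'p.mem_of_pow_mem n h)
  set 𝔔L : Ideal L := 𝔔'.map (algebraMap (AdjoinRoot P) L) with h𝔔L
  haveI h𝔔Lp : 𝔔L.IsPrime := IsLocalization.isPrime_of_isPrime_disjoint (Submonoid.powers t) L 𝔔' h𝔔'p hdisj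
  have hcomapL : 𝔔L.comap (algebraMap (AdjoinRoot P) L) = 𝔔' :=
    IsLocalization.under_map_of_isPrime_disjoint (Submonoid.powers t) L h𝔔'p hdisj
  have hÃ : AddMonoid.IsTorsion (A × ZMod d) := fun p => isOfFinAddOrder_of_finite p
  obtain ⟨B', hB'L, -⟩ := StabilizerSubgroup.exists_unitDegrees_addSubgroup ℒ hÃ 𝔔L
  have hB' : ∀ p : A × ZMod d, p ∈ B' ↔ ∃ x ∈ 𝒯 p, x ∉ 𝔔' := fun p =>
    (hB'L p).trans (unitDegrees_away_iff 𝒯 hT L 𝔔' htQ p)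
  let C' : AddSubgroup (A × ZMod d) := (⊥ : AddSubgroup A).prod (⊤ : AddSubgroup (ZMod d))
  have hsup : B' ⊔ C' = ⊤ :=
    RootAdjoinUnits.sup_prod_eq_top 𝒮 d u a 𝒯 h𝒯 𝔔 𝔔' h𝔔' B hB B' hB' huQ hgen
  have hinf : B' ⊓ C' = ⊥ :=
    RootAdjoinUnits.inf_prod_eq_bot 𝒮 d u a 𝒯 h𝒯 𝔔 𝔔' h𝔔' B hB B' hB' hmin
  -- the chart map `Spec (L_0) → Spec (S̃_0) ≅ Spec S₀ → X`
  let j : 𝒯 0 →+* ℒ 0 := locPieceZeroHom 𝒯 (Submonoid.powers t) hT L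
  have hjval : ∀ y, (j y : L) = algebraMap (AdjoinRoot P) L y := fun y => rfl
  have hjet : j.Etale := FixedChart.etale_locPieceZeroHom 𝒯 ht0 hT L
  haveI : Etale (Spec.map (CommRingCat.ofHom j)) := (HasRingHomProperty.Spec_iff (P := @Etale)).mpr hjet
  haveI : IsIso (CommRingCat.ofHom (R := 𝒮 0) (S := 𝒯 0) e.toRingHom) := by
    show IsIso (RingEquiv.toCommRingCatIso (R := 𝒮 0) (S := 𝒯 0) e).hom
    infer_instance
  let φL : Spec (.of (ℒ 0)) ⟶ X :=
    Spec.map (CommRingCat.ofHom j) ≫ Spec.map (CommRingCat.ofHom (R := 𝒮 0) (S := 𝒯 0) e.toRingHom) ≫ φ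
  haveI hφLet : Etale φL := inferInstance
  have hφLg : φL ≫ g = Spec.map (CommRingCat.ofHom (algebraMap k (ℒ 0))) := by
    simp only [φL, Category.assoc, hφg, ← Spec.map_comp]
    congr 1
    refine CommRingCat.hom_ext (RingHom.ext fun c => ?_)
    apply Subtype.ext
    simp only [CommRingCat.hom_comp, CommRingCat.hom_ofHom, RingHom.coe_comp, Function.comp_apply]
    show ((j (e (algebraMap k (𝒮 0) c))) : L) = ((algebraMap k (ℒ 0) c) : L)
    rw [hjval, he, SetLike.GradeZero.coe_algebraMap, SetLike.GradeZero.coe_algebraMap, ← AdjoinRoot.algebraMap_eq,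
      ← IsScalarTower.algebraMap_apply, ← IsScalarTower.algebraMap_apply]
  -- the point of `Spec (L_0)` under `𝔔L` maps to `v`
  let vL : Spec (.of (ℒ 0)) := ⟨𝔔L.comap (algebraMap (ℒ 0) L), Ideal.IsPrime.comap _⟩
  have hvL : φL vL = φ v := by
    show φ (Spec.map (CommRingCat.ofHom (R := 𝒮 0) (S := 𝒯 0) e.toRingHom) (Spec.map (CommRingCat.ofHom j) vL)) = φ v
    congr 1
    apply PrimeSpectrum.ext
    rw [Spec.map_apply, PrimeSpectrum.comap_asIdeal, Spec.map_apply, PrimeSpectrum.comap_asIdeal]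
    show ((𝔔L.comap (algebraMap (ℒ 0) L)).comap j).comap e.toRingHom = v.asIdeal
    have h1 : (𝔔L.comap (algebraMap (ℒ 0) L)).comap j = 𝔔'.comap (algebraMap (𝒯 0) (AdjoinRoot P)) := by
      rw [Ideal.comap_comap, ← hcomapL, Ideal.comap_comap]
      exact congrArg (fun f => Ideal.comap f 𝔔L) (RingHom.ext fun _ => rfl)
    rw [h1, RootAdjoinUnits.comap_comap_ringEquiv 𝒮 d u a 𝒯 h𝒯 𝔔' e he, h𝔔', h𝔔v]
  -- (S) the split-off step on the chart `(A × ZMod d, L)`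
  obtain ⟨A', i1, i2, i3, S', i4, i5, 𝒮', i6, hft', hreg', φ', hφ'et, hφ'g, v', 𝔔'', h𝔔''p, h𝔔''v', hfix, hφ'v'⟩ :=
    FixedChartOfSummand.exists_fixed_chart_of_isCompl k X g (A × ZMod d) L ℒ φL hφLg vL 𝔔L rfl B' C' hB'L hsup hinf
  exact ⟨A', i1, i2, i3, S', i4, i5, 𝒮', i6, hft', hreg', φ', hφ'et, hφ'g, v', 𝔔'', h𝔔''p, h𝔔''v', hfix,
    hφ'v'.trans hvL⟩

end Summit.ResolutionOfSingularities.ResolutionOfSingularities.Theorems.FRationalResolution.FixedChartOfRoot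

end
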